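import Mathlib
import Summits.ResolutionOfSingularities.ResolutionOfSingularities.Theorems.HomologicalConductorNoZenoFullSheafLocallyFree
import Summits.ResolutionOfSingularities.ResolutionOfSingularities.Theorems.HomologicalConductorNoZenoFullSheafPresentation
import HarnessLib

/-!
# Full sheaves: `M̃ = 𝒪_X · φ(M)` is finite locally free (G2 (iv) assembled with G2 (iii), chain W4.4)

`[OURS · L W4.4]` Crux `HomologicalConductor.NoZenoR` (stmt-ResolutionOfSingularities-19943; twin `NoZeno`
stmt-16483), line `sandwich-cluster`, S3 Layer 2, G-layer item **G2 (iv)** in the signature of the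
holder's cut (res-D-pv-045, `SketchG2Split.lean` 4f3b6bfe6d08dd54, clause (iv)
`fullSheaf_isFiniteLocallyFree`), now with clause (iii) DISCHARGED by res-D-pv-024's
`fullSheaf_cechMH1_subsingleton` (`…FullSheafPresentation`): the only extra binder is that theorem's
named fact `h24 : GortzWedhorn2023_24_44_H2` (Görtz–Wedhorn II Cor. 24.44 = EGA III (4.2.2), `Ȟ² = 0`
above the fibre dimension), exactly as in the rest of the G-layer (`lemmaL_of_GW`).

* **`fullSheaf_isFiniteLocallyFree`** — for `T` a two-dimensional noetherian normal local domain,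
  `π : X ⟶ Spec T` a resolution with `Ȟ¹(𝒰, 𝒪_X) = 0` on finite affine covers (`HasTrivialCechH1 π`),
  `M` a finitely generated reflexive `T`-module and `φ : M ↪ K(X)^r` `T`-semilinear along `T → K(X)`:
  **the full sheaf `𝒪_X · φ(M)` is finite locally free** (p510095
  `fullSheaf_isFiniteLocallyFree_of_cechH1` + (iii));
* `fullSheaf_isVectorBundle` — hence a vector bundle (`Motives.IsFiniteLocallyFree.isVectorBundle`).

Replaces the role of no printed item of the manuscript under review (Hironaka 2017); AI-written, weaker
than expert review. [cite: ArtinVerdier1985, Lemma (1.1) (ii)] [cite: GortzWedhorn2023, Cor. 24.44]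
-/

-- single-problem summit: the doubled namespace component `ResolutionOfSingularities` is forced
set_option linter.dupNamespace false

noncomputable section

open CategoryTheory AlgebraicGeometry TopologicalSpace Opposite
open Literature.AlgebraicGeometry.Resolution Literature.AlgebraicGeometry.Motives
open Literature.AlgebraicGeometry.Morphisms Literature.AlgebraicGeometry.Modules

namespace Summit.ResolutionOfSingularities.ResolutionOfSingularities.Theorems.NoZeno.SandwichCluster.FullSheaf

variable (T : Type) [CommRing T] [IsDomain T] [IsNoetherianRing T] [IsLocalRing T] [IsIntegrallyClosed T]
variable (X : Scheme.{0}) [IsIntegral X] [IsLocallyNoetherian X] (π : X ⟶ Spec (.of T))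
variable (M : Type) [AddCommGroup M] [Module T M] [Module.Finite T M]
variable {r : ℕ} (φ : M →+ (Fin r → X.functionField))

/-- **G2 (iv): the full sheaf `M̃ = 𝒪_X · φ(M)` of a finitely generated reflexive module over a
two-dimensional noetherian normal local domain `T` is finite locally free on any resolution
`π : X ⟶ Spec T` with `Ȟ¹(𝒰, 𝒪_X) = 0`** (`φ : M ↪ K(X)^r` semilinear along `T → K(X)`), modulo the
named fact `GortzWedhorn2023_24_44_H2` through G2 (iii) (`fullSheaf_cechMH1_subsingleton`).  Clause (iv)
of `SketchG2Split.lean` with the one extra binder `h24`. [cite: ArtinVerdier1985, Lemma (1.1) (ii)] -/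
theorem fullSheaf_isFiniteLocallyFree (hdim : ringKrullDim T = 2) (hπ : IsResolution π)
    (hrat : HasTrivialCechH1 π) (h24 : GortzWedhorn2023_24_44_H2.{0}) (hM : Module.IsReflexive T M)
    (hφ : ∀ (a : T) (m : M), φ (a • m) = baseToFunctionField π a • φ m) (hφinj : Function.Injective φ) :
    IsFiniteLocallyFree (generatedSheaf (X := X) (Fin r → X.functionField) (Set.range φ)) :=
  fullSheaf_isFiniteLocallyFree_of_cechH1 π φ hdim hπ hM hφ hφinj
    fun _ _ U hU hcov => fullSheaf_cechMH1_subsingleton T X π M φ hdim hπ hrat h24 hφ U hU hcov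

/-- **The full sheaf `𝒪_X · φ(M)` is a vector bundle** (same hypotheses).
[cite: ArtinVerdier1985, Lemma (1.1) (ii)] -/
theorem fullSheaf_isVectorBundle (hdim : ringKrullDim T = 2) (hπ : IsResolution π)
    (hrat : HasTrivialCechH1 π) (h24 : GortzWedhorn2023_24_44_H2.{0}) (hM : Module.IsReflexive T M)
    (hφ : ∀ (a : T) (m : M), φ (a • m) = baseToFunctionField π a • φ m) (hφinj : Function.Injective φ) :
    IsVectorBundle (generatedSheaf (X := X) (Fin r → X.functionField) (Set.range φ)) :=
  (fullSheaf_isFiniteLocallyFree T X π M φ hdim hπ hrat h24 hM hφ hφinj).isVectorBundle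

end Summit.ResolutionOfSingularities.ResolutionOfSingularities.Theorems.NoZeno.SandwichCluster.FullSheaf

end
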